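import Summits.Schanuel.Schanuel.Theorems.ZilberEacRealLineDensity
import HarnessLib

/-!
# Real irrational slopes: Gallinaro's recurring example `L_{√2} × {w₁ + w₂ + 1 = 0}`

Zilber's Exponential-Algebraic Closedness, case ladder (host summit Schanuel, cell `pub-schanuel`,
seat 2, gen 7).  Two named instances of `ZilberEacRealLineDensity.unprojectedDense_line_of_irrational`.

Gallinaro, *Exponential sums equations and tropical geometry*, Selecta Math. 29 (2023), Example 3.4
(p. 6 of arXiv:2203.13767) takes `L_{√2} × W`, `L_{√2} = {z₂ = √2 z₁}`, `W = {w₁ + w₂ + 1 = 0}`, as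
the paper's recurring example: its exponential points are the solutions of `e^{z} + e^{√2 z} + 1 = 0`,
and their EXISTENCE is an instance of his Theorem (`L × W` free rotund, `L` linear).  In the tree's
dictionary this is the line surface `{x₁ = √2 x₀, y₀ = -y₁ - 1}`; the theorem below says that these
solutions are moreover ZARISKI DENSE in `L_{√2} × W` (`I(S ∩ Γ_exp) = I(S)`) — the unprojected
density Mantova–Masser (Proc. LMS 2024, §1 p. 5) call "unclear, even for `n = 2`", decided for this
surface.  HONEST FRAMING: an instance of an open question's positive side; nothing here bears on
Schanuel's conjecture; `ECCell 3 2` OPEN.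
-/

noncomputable section

open Complex
open Literature.NumberTheory.Transcendental Literature.ModelTheory.Zilber

set_option linter.dupNamespace false

namespace Summit.Schanuel.Schanuel.Theorems

/-- **Gallinaro's example is dense**: the solutions of `e^{z} + e^{√2 z} + 1 = 0` (with
`w = e^{√2 z}`) are Zariski dense in `{x₁ = √2 x₀, y₀ = -y₁ - 1} = L_{√2} × {w₁ + w₂ + 1 = 0}`. -/
theorem unprojectedDense_gallinaro_example :
    UnprojectedDense (graphPolySurface (linePoly (Real.sqrt 2 : ℂ) 0)
      (-Polynomial.X - Polynomial.C 1)) :=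
  unprojectedDense_line_of_irrational irrational_sqrt_two 0 (by
    intro h
    have := congrArg (Polynomial.eval (0 : ℂ)) h
    norm_num at this)

/-- The equation form: `e^{z} + e^{√2 z} + 1 = 0` has a solution (Gallinaro 2023, Example 3.4;
here from the tree). -/
theorem gallinaro_example_solvable : ∃ z : ℂ, exp z + exp ((Real.sqrt 2 : ℂ) * z) + 1 = 0 := by
  obtain ⟨z, hz⟩ := exists_exp_eq_eval_exp_of_irrational irrational_sqrt_two 0
    (q := -Polynomial.X - Polynomial.C 1) (by
      intro h
      have := congrArg (Polynomial.eval (0 : ℂ)) h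
      norm_num at this)
  refine ⟨z, ?_⟩
  simp only [add_zero, Polynomial.eval_sub, Polynomial.eval_neg, Polynomial.eval_X,
    Polynomial.eval_C] at hz
  linear_combination hz

/-- The same for the cubic fibre `w₁ = w₂³ - 2 w₂` over the slope `√2`: the solutions of
`e^{z} = e^{3√2 z} - 2 e^{√2 z}` are Zariski dense in `{x₁ = √2 x₀, y₀ = y₁³ - 2 y₁}` (a fibre with
`q(0) = 0`, so the fibre twist of `EACDensityLineTwist` is used inside the proof). -/
theorem unprojectedDense_sqrt_two_cubic_fibre :
    UnprojectedDense (graphPolySurface (linePoly (Real.sqrt 2 : ℂ) 0)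
      (Polynomial.X ^ 3 - Polynomial.C 2 * Polynomial.X)) :=
  unprojectedDense_line_of_irrational irrational_sqrt_two 0 (by
    intro h
    have := congrArg (Polynomial.eval (1 : ℂ)) h
    norm_num at this)

end Summit.Schanuel.Schanuel.Theorems

end
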